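import Summits.BirchSwinnertonDyer.BirchSwinnertonDyer.Theorems.AdditiveKolyvaginRoadAdmissibleRaise
import Summits.BirchSwinnertonDyer.BirchSwinnertonDyer.Theorems.AdditiveKolyvaginRoadToricTransLocal
import Summits.BirchSwinnertonDyer.BirchSwinnertonDyer.Theorems.AdditiveKolyvaginRoadKolyvaginTransverseIsotropy
import Summits.BirchSwinnertonDyer.BirchSwinnertonDyer.Theorems.AdditiveKolyvaginRoadKolyvaginRelaxedStab
import Summits.BirchSwinnertonDyer.BirchSwinnertonDyer.Theorems.AdditiveKolyvaginRoadTwoPrimeJumpPrelims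
import Summits.BirchSwinnertonDyer.BirchSwinnertonDyer.Theorems.AdditiveKolyvaginRoadLevelSystemsOfSelmerDichotomy
import HarnessLib

/-!
# Route `AdditiveKolyvaginRoad`, crux `LevelKolyvaginSystemsAdditive` (item stmt-BirchSwinnertonDyer-21396, KS′):
# the level structure TRANSVERSE on `m` RELAXED at an admissible place — (Stab), (Trans), (REC) and the hyperbolic
# dichotomy, E-side; tools for binder (A²) of the synthetic level Kolyvagin system
# (cell `pub/bsd-wall`, width seat `bsd-wall-akr-p2x-w5` g0; `--supports stmt-BirchSwinnertonDyer-21396`, helper;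
# consumed by `…LevelSystemsDichotomyTwoStepOfPoitouTate`)

SETTING. A finite set `N` of Bertolini–Darmon admissible primes, a finite set `m` of Kolyvagin primes, an admissible `q ∉ N`
with place `w ∋ q`. A class `z ∈ H¹(K, E[p])` is RELAXED-AT-`w` for `(N, m)` when it is Kummer at the infinite places and
at the finite places `v ≠ w` above no prime of `N ∪ m`, TORIC above the primes of `N`, TRANSVERSE (`transverseLocalKerP`)
above the primes of `m` (the four displayed clauses; no condition at `w`). Both mixed spaces `𝒮 N m μ` and `𝒮 (N ∪ q) m μ`
of the synthetic system consist of such classes.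

WHAT.
* `moduleFinite_of_levelDictionary` — a family with the membership dictionary of the mixed spaces is finite-dimensional
  (it coincides with the intended family of `exists_transverseLevelSpaces`): the binder `hfin` is automatic.
* `conjAct_mem_relaxedTransverseAt` — (Stab): complex conjugation `c_*` preserves the four clauses (Gross (5.1); Kummer
  and toric by Galois transport of completions, transverse by `conjAct_mem_transverseLocalKerP_of_mem`).
* `mem_torsionLocalKer_of_selmer_of_toric_admQ` — (Trans) in global currency: Kummer AND toric at `w` ⟹ locally trivial
  at `w` (`ToricFrob.selmerLocalKer_inf_toricLocalKer_le_torsionLocalKer`, Bertolini–Darmon Lemma 2.6).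
* `invWeilPairing_localization_eq_zero_of_relaxedTransverse` — (REC): for two relaxed classes the local term
  `inv_w(loc_w x ∪ₑ loc_w y)` vanishes: Poitou–Tate (`sum_invWeilPairing_localization_eq_zero_of_mem_kummerOutside` over
  `S' = {w} ∪ {v ∣ N} ∪ {v ∣ m}`) with the toric (`htorIso_toricLocalCondition`) and transverse
  (`cupProduct_eq_zero_of_mem_transverseLocalKerP`) isotropies killing the other terms.
* `mem_selmerLocalKer_or_mem_toricLocalKer_of_relaxedTransverse` — the HYPERBOLIC DICHOTOMY for relaxed classes, from
  the named PT fact alone: a relaxed class is Kummer or toric at `w` (`(REC)` with `x = y`, then the witness-free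
  `mem_selmerLocalKer_or_mem_toricLocalKer_of_isotropic_free`).

HONEST FRAMING: theorems only; 0 definitions, 0 named facts, 0 `sorry`; the dichotomy is CONDITIONAL on
`poitouTate_selmerStructure_duality K`; closes nothing. BSD is not proved by any of this.

References: [cite: WZhang2014, Lemma 5.1, Lemma 5.3, §8.1, §9 (9.2)] [cite: BertoliniDarmon2005, §2.2–§2.3, Lemma 2.6]
[cite: GrossLMS1991, §5 (5.1)] [cite: MilneADT2006, Ch. I, Cor. 2.3, Thm. 4.10] [cite: PoonenRains2012, Prop. 4.10].
-/

-- single-conjunct summit: `Summit.BirchSwinnertonDyer.BirchSwinnertonDyer.…` repeats the name by design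
set_option linter.dupNamespace false

noncomputable section

open scoped Classical NumberField Pointwise
open Function NumberField IsDedekindDomain Field WeierstrassCurve
open Literature.NumberTheory.EllipticCurves Literature.NumberTheory.EllipticCurves.ModularForms
open Literature.NumberTheory.GaloisRepresentations Literature.NumberTheory.GaloisRepresentations.DiscreteGaloisModule
  Literature.NumberTheory.GaloisCohomology Module
open Summit.BirchSwinnertonDyer.Rank1Residual.X11b.FiniteDuality
open Summit.BirchSwinnertonDyer.Rank1Residual.X11b.Relaxation
open Summit.BirchSwinnertonDyer.Rank1Residual.X11b
open Summit.BirchSwinnertonDyer.Rank1Residual.GaloisImage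
open Summit.BirchSwinnertonDyer.Rank1Residual.X11b.Three.Koly.Method2
open Summit.BirchSwinnertonDyer.Rank1Residual.X11b.Three.Koly.ZhangSupply.LocalConj
open Literature.NumberTheory.Automorphic

namespace Summit.BirchSwinnertonDyer.BirchSwinnertonDyer.Theorems.AdditiveKoly

variable (W : WeierstrassCurve ℚ) (K : Type) [Field K] [NumberField K] (p : ℕ) [W.IsElliptic] [W.IsGloballyMinimal]
  [Fact p.Prime] (ι : K →+* ℂ) (c : K ≃ₐ[ℚ] K)

/-! ## §1 Finiteness of a family with the dictionary -/

/-- **A family with the membership dictionary is finite-dimensional**: the dictionary pins `𝒮 n m μ` as a set, and the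
intended family (`exists_transverseLevelSpaces`: a subgroup of the finite `levelSelmerSubgroupP`) has the same dictionary.
So the binder `hfin` of `nonempty_levelKolyvaginSystemP_of_selmerDichotomy` is automatic for every such `𝒮`.
[cite: WZhang2014, §5 (Sel_{𝔭_n}), §8.1] -/
theorem moduleFinite_of_levelDictionary [Module (ZMod p) (Vp W K p)]
    (𝒮 : Finset (AdmQ W K p) → Finset {ℓ // Zhang2014.IsKolyvaginPrime (W.conductorNorm ℤ) W K p ℓ} → Bool →
      Submodule (ZMod p) (Vp W K p))
    (h𝒮 : ∀ (n : Finset (AdmQ W K p)) (m : Finset {ℓ // Zhang2014.IsKolyvaginPrime (W.conductorNorm ℤ) W K p ℓ})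
      (μ : Bool) (x : Vp W K p), x ∈ 𝒮 n m μ ↔
        conjAct W c ((p ^ 1 : ℕ) : ℤ) x = sgnP μ • x ∧
        (∀ w : InfinitePlace K, x ∈ selmerLocalKer (W.baseChange K) w.Completion ((p ^ 1 : ℕ) : ℤ)) ∧
        (∀ v : HeightOneSpectrum (𝓞 K), (∀ ℓ ∈ m, ((ℓ : ℕ) : 𝓞 K) ∉ v.asIdeal) → (∀ q ∈ n, ((q : ℕ) : 𝓞 K) ∉ v.asIdeal) →
          x ∈ selmerLocalKer (W.baseChange K) (v.adicCompletion K) ((p ^ 1 : ℕ) : ℤ)) ∧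
        (∀ q ∈ n, ∀ v : HeightOneSpectrum (𝓞 K), ((q : ℕ) : 𝓞 K) ∈ v.asIdeal →
          x ∈ toricLocalKer (W.baseChange K) (v.adicCompletion K) ((p ^ 1 : ℕ) : ℤ)) ∧
        (∀ ℓ ∈ m, ∀ v : HeightOneSpectrum (𝓞 K), ((ℓ : ℕ) : 𝓞 K) ∈ v.asIdeal → x ∈ transverseLocalKerP W K p ι ℓ v)) :
    ∀ n m μ, Module.Finite (ZMod p) (𝒮 n m μ) := by
  obtain ⟨𝒮₀, h𝒮₀, hfin₀⟩ := exists_transverseLevelSpaces W K p ι c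
  intro n m μ
  have heq : 𝒮 n m μ = 𝒮₀ n m μ := by
    ext x
    rw [h𝒮, h𝒮₀]
  rw [heq]
  exact hfin₀ n m μ

/-! ## §2 (Stab) and (Trans) for the relaxed structure -/

omit [W.IsElliptic] [Fact p.Prime] in
/-- **(Stab) for the level structure transverse on `m`, relaxed at an admissible place** (Gross (5.1)): for `K` imaginary
quadratic and `c ≠ 1`, if `x` is Kummer at `∞`, Kummer at the finite `v ≠ w` above no prime of `N ∪ m`, toric above `N`
and transverse above `m` (`w ∋ q` the place of an admissible `q`), then so is `c_* x`. Kummer ∕ toric clauses by Galois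
transport of completions (`conjAct_mem_selmerLocalKer_iff`, `conjAct_mem_toricLocalKer_adicCompletion_iff`; `w` is fixed by
`c`), the transverse clause by `conjAct_mem_transverseLocalKerP_of_mem`. [cite: GrossLMS1991, §5 (5.1)]
[cite: WZhang2014, §8.1] -/
theorem conjAct_mem_relaxedTransverseAt (hK : IsImaginaryQuadratic K) (hc : c ≠ 1)
    (N : Finset (AdmQ W K p)) (m : Finset {ℓ // Zhang2014.IsKolyvaginPrime (W.conductorNorm ℤ) W K p ℓ})
    (q : AdmQ W K p) (w : HeightOneSpectrum (𝓞 K)) (hqw : ((q : ℕ) : 𝓞 K) ∈ w.asIdeal) (x : Vp W K p)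
    (hx : (∀ u : InfinitePlace K, x ∈ selmerLocalKer (W.baseChange K) u.Completion ((p ^ 1 : ℕ) : ℤ)) ∧
      (∀ v : HeightOneSpectrum (𝓞 K), v ≠ w → (∀ ℓ ∈ m, ((ℓ : ℕ) : 𝓞 K) ∉ v.asIdeal) →
        (∀ q' ∈ N, ((q' : ℕ) : 𝓞 K) ∉ v.asIdeal) →
          x ∈ selmerLocalKer (W.baseChange K) (v.adicCompletion K) ((p ^ 1 : ℕ) : ℤ)) ∧
      (∀ q' ∈ N, ∀ v : HeightOneSpectrum (𝓞 K), ((q' : ℕ) : 𝓞 K) ∈ v.asIdeal →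
          x ∈ toricLocalKer (W.baseChange K) (v.adicCompletion K) ((p ^ 1 : ℕ) : ℤ)) ∧
      (∀ ℓ ∈ m, ∀ v : HeightOneSpectrum (𝓞 K), ((ℓ : ℕ) : 𝓞 K) ∈ v.asIdeal → x ∈ transverseLocalKerP W K p ι ℓ v)) :
    (∀ u : InfinitePlace K,
        conjAct W c ((p ^ 1 : ℕ) : ℤ) x ∈ selmerLocalKer (W.baseChange K) u.Completion ((p ^ 1 : ℕ) : ℤ)) ∧
      (∀ v : HeightOneSpectrum (𝓞 K), v ≠ w → (∀ ℓ ∈ m, ((ℓ : ℕ) : 𝓞 K) ∉ v.asIdeal) →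
        (∀ q' ∈ N, ((q' : ℕ) : 𝓞 K) ∉ v.asIdeal) →
          conjAct W c ((p ^ 1 : ℕ) : ℤ) x ∈ selmerLocalKer (W.baseChange K) (v.adicCompletion K) ((p ^ 1 : ℕ) : ℤ)) ∧
      (∀ q' ∈ N, ∀ v : HeightOneSpectrum (𝓞 K), ((q' : ℕ) : 𝓞 K) ∈ v.asIdeal →
          conjAct W c ((p ^ 1 : ℕ) : ℤ) x ∈ toricLocalKer (W.baseChange K) (v.adicCompletion K) ((p ^ 1 : ℕ) : ℤ)) ∧
      (∀ ℓ ∈ m, ∀ v : HeightOneSpectrum (𝓞 K), ((ℓ : ℕ) : 𝓞 K) ∈ v.asIdeal →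
          conjAct W c ((p ^ 1 : ℕ) : ℤ) x ∈ transverseLocalKerP W K p ι ℓ v) := by
  haveI : IsTotallyComplex K := hK.2
  have hnat : ∀ (σ : K ≃ₐ[ℚ] K) (v : HeightOneSpectrum (𝓞 K)) (q : ℕ),
      (q : 𝓞 K) ∈ (σ • v).asIdeal ↔ (q : 𝓞 K) ∈ v.asIdeal := by
    intro σ v q
    have hq : σ • (q : 𝓞 K) = (q : 𝓞 K) := map_natCast (MulSemiringAction.toRingHom (K ≃ₐ[ℚ] K) (𝓞 K) σ) q
    rw [← HeightOneSpectrum.smul_mem_smul_asIdeal_iff σ v (q : 𝓞 K), hq]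
  refine ⟨fun u ↦ ?_, fun v hv hvm hvN ↦ ?_, fun q' hq' v hv ↦ ?_, fun ℓ hℓ v hv ↦ ?_⟩
  · haveI : IsAlgClosed u.Completion :=
      isAlgClosed_of_ringEquiv (InfinitePlace.Completion.ringEquivComplexOfIsComplex (IsTotallyComplex.isComplex u)).symm
    rw [WeierstrassCurve.selmerLocalKer_eq_top_of_isAlgClosed]
    trivial
  · have h0 : c • (c⁻¹ • v) = v := smul_inv_smul c v
    have hv₀ : c⁻¹ • v ≠ w := by
      intro h
      have h1 : ((q : ℕ) : 𝓞 K) ∈ (c⁻¹ • v).asIdeal := by rw [h]; exact hqw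
      exact hv ((mem_asIdeal_iff_eq_of_admQ W K p q w hqw v).mp ((hnat c⁻¹ v q).mp h1))
    have hv₀m : ∀ ℓ ∈ m, ((ℓ : ℕ) : 𝓞 K) ∉ (c⁻¹ • v).asIdeal := fun ℓ hℓ h ↦ hvm ℓ hℓ ((hnat c⁻¹ v ℓ).mp h)
    have hv₀N : ∀ q' ∈ N, ((q' : ℕ) : 𝓞 K) ∉ (c⁻¹ • v).asIdeal :=
      fun q' hq' h ↦ hvN q' hq' ((hnat c⁻¹ v q').mp h)
    haveI : CharZero ((c⁻¹ • v).adicCompletion K) := charZero_of_injective_algebraMap (algebraMap K _).injective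
    haveI : CharZero (v.adicCompletion K) := charZero_of_injective_algebraMap (algebraMap K _).injective
    exact (conjAct_mem_selmerLocalKer_iff W c (galAdicCompletionEquiv (L := K) c h0)
      (isSemilinearRingEquiv_galAdicCompletionEquiv c h0) _ x).mpr (hx.2.1 (c⁻¹ • v) hv₀ hv₀m hv₀N)
  · have h0 : c • (c⁻¹ • v) = v := smul_inv_smul c v
    exact (conjAct_mem_toricLocalKer_adicCompletion_iff W c h0 _ x).mpr
      (hx.2.2.1 q' hq' (c⁻¹ • v) ((hnat c⁻¹ v q').mpr hv))
  · exact conjAct_mem_transverseLocalKerP_of_mem W p hK hc ι ℓ.2.1 ℓ.2.2.2.2.2.1 hv (hx.2.2.2 ℓ hℓ v hv)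

/-- **(Trans) at an admissible place, global currency**: a class which is Kummer AND toric at the place `w ∋ q` of a
Bertolini–Darmon admissible prime is locally trivial at `w` (`q ∤ pN` gives good reduction at `w ∤ p`; then
`ToricFrob.selmerLocalKer_inf_toricLocalKer_le_torsionLocalKer`). [cite: BertoliniDarmon2005, Lemma 2.6] -/
theorem mem_torsionLocalKer_of_selmer_of_toric_admQ (q : AdmQ W K p) (w : HeightOneSpectrum (𝓞 K))
    (hqw : ((q : ℕ) : 𝓞 K) ∈ w.asIdeal) (z : Vp W K p)
    (hzK : z ∈ selmerLocalKer (W.baseChange K) (w.adicCompletion K) ((p ^ 1 : ℕ) : ℤ))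
    (hzT : z ∈ toricLocalKer (W.baseChange K) (w.adicCompletion K) ((p ^ 1 : ℕ) : ℤ)) :
    z ∈ (W.baseChange K).torsionLocalKer (w.adicCompletion K) ((p ^ 1 : ℕ) : ℤ) := by
  have hp : p.Prime := Fact.out
  obtain ⟨hgood, hpv⟩ := hasGoodReductionAt_of_isAdmissiblePrime W K q.2 w hqw
  obtain ⟨𝔐, h𝔐⟩ := w.localPrimesAbove_nonempty
  have hpv' : (((p ^ 1 : ℕ) : ℤ) : 𝓞 K) ∉ w.asIdeal := by rw [pow_one]; exact hpv
  exact ToricFrob.selmerLocalKer_inf_toricLocalKer_le_torsionLocalKer (W.baseChange K) hgood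
    (pow_ne_zero 1 hp.ne_zero) hpv' h𝔐 (AddSubgroup.mem_inf.mpr ⟨hzK, hzT⟩)

/-! ## §3 (REC) at the relaxed place and the hyperbolic dichotomy -/

variable
  -- cup products need the compactness of the local absolute Galois groups (binder, discharged by
  -- `absoluteGaloisGroup_compactSpace` at the call site)
  [∀ v : Place K, CompactSpace (absoluteGaloisGroup (Place.Completion v))]

/-- **(REC) at the relaxed admissible place.** `K` imaginary quadratic, `p` odd; `e` a Weil pairing on `E[p]`, `inv` a
Poitou–Tate family with `SumLocalTermEqZero`. For two classes `x, y` of the level structure `(N, m)` relaxed at the place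
`w ∋ q` (`q ∉ N` admissible), the local term `inv_w(loc_w x ∪ₑ loc_w y)` vanishes: both lie in `kummerOutside S'` for
`S' = {w} ∪ {v ∣ N} ∪ {v ∣ m}`, Poitou–Tate gives `∑_{S'} = 0`, and the terms above `N` (toric isotropy) and above `m`
(transverse isotropy) vanish. [cite: MilneADT2006, Ch. I, Thm. 4.10] [cite: WZhang2014, §8.1, Lemma 5.1]
[cite: PoonenRains2012, Prop. 4.10] -/
theorem invWeilPairing_localization_eq_zero_of_relaxedTransverse (hK : IsImaginaryQuadratic K) (hp2 : p ≠ 2)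
    (e : geomTorsion (W.baseChange K) ((p ^ 1 : ℕ) : ℤ) → geomTorsion (W.baseChange K) ((p ^ 1 : ℕ) : ℤ) →
      AlgebraicClosure K)
    (hμ : ∀ P Q, e P Q ^ (p ^ 1) = 1) (hadd₁ : ∀ P₁ P₂ Q, e (P₁ + P₂) Q = e P₁ Q * e P₂ Q)
    (hadd₂ : ∀ P Q₁ Q₂, e P (Q₁ + Q₂) = e P Q₁ * e P Q₂) (halt : ∀ Q, e Q Q = 1)
    (hgal : ∀ (σ : absoluteGaloisGroup K) (P Q : geomTorsion (W.baseChange K) ((p ^ 1 : ℕ) : ℤ)),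
      σ • e P Q = e (σ • P) (σ • Q))
    (inv : LocalInvariants K (p ^ 1)) (hsum : inv.SumLocalTermEqZero)
    (N : Finset (AdmQ W K p)) (m : Finset {ℓ // Zhang2014.IsKolyvaginPrime (W.conductorNorm ℤ) W K p ℓ})
    (q : AdmQ W K p) (w : HeightOneSpectrum (𝓞 K)) (hqN : q ∉ N) (hqw : ((q : ℕ) : 𝓞 K) ∈ w.asIdeal)
    (x y : Vp W K p)
    (hx : (∀ u : InfinitePlace K, x ∈ selmerLocalKer (W.baseChange K) u.Completion ((p ^ 1 : ℕ) : ℤ)) ∧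
      (∀ v : HeightOneSpectrum (𝓞 K), v ≠ w → (∀ ℓ ∈ m, ((ℓ : ℕ) : 𝓞 K) ∉ v.asIdeal) →
        (∀ q' ∈ N, ((q' : ℕ) : 𝓞 K) ∉ v.asIdeal) →
          x ∈ selmerLocalKer (W.baseChange K) (v.adicCompletion K) ((p ^ 1 : ℕ) : ℤ)) ∧
      (∀ q' ∈ N, ∀ v : HeightOneSpectrum (𝓞 K), ((q' : ℕ) : 𝓞 K) ∈ v.asIdeal →
          x ∈ toricLocalKer (W.baseChange K) (v.adicCompletion K) ((p ^ 1 : ℕ) : ℤ)) ∧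
      (∀ ℓ ∈ m, ∀ v : HeightOneSpectrum (𝓞 K), ((ℓ : ℕ) : 𝓞 K) ∈ v.asIdeal → x ∈ transverseLocalKerP W K p ι ℓ v))
    (hy : (∀ u : InfinitePlace K, y ∈ selmerLocalKer (W.baseChange K) u.Completion ((p ^ 1 : ℕ) : ℤ)) ∧
      (∀ v : HeightOneSpectrum (𝓞 K), v ≠ w → (∀ ℓ ∈ m, ((ℓ : ℕ) : 𝓞 K) ∉ v.asIdeal) →
        (∀ q' ∈ N, ((q' : ℕ) : 𝓞 K) ∉ v.asIdeal) →
          y ∈ selmerLocalKer (W.baseChange K) (v.adicCompletion K) ((p ^ 1 : ℕ) : ℤ)) ∧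
      (∀ q' ∈ N, ∀ v : HeightOneSpectrum (𝓞 K), ((q' : ℕ) : 𝓞 K) ∈ v.asIdeal →
          y ∈ toricLocalKer (W.baseChange K) (v.adicCompletion K) ((p ^ 1 : ℕ) : ℤ)) ∧
      (∀ ℓ ∈ m, ∀ v : HeightOneSpectrum (𝓞 K), ((ℓ : ℕ) : 𝓞 K) ∈ v.asIdeal → y ∈ transverseLocalKerP W K p ι ℓ v)) :
    invWeilPairing (W.baseChange K) (p ^ 1) e hμ hadd₁ hadd₂ hgal inv (Sum.inr w)
      (galoisCohomology.localization ((W.baseChange K).torsionGaloisModule ((p ^ 1 : ℕ) : ℤ)) (Sum.inr w) 1 x)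
      (galoisCohomology.localization ((W.baseChange K).torsionGaloisModule ((p ^ 1 : ℕ) : ℤ)) (Sum.inr w) 1 y) = 0 := by
  have hp : p.Prime := Fact.out
  haveI : NeZero (p ^ 1 : ℕ) := ⟨pow_ne_zero 1 hp.ne_zero⟩
  haveI : IsTotallyComplex K := hK.2
  have hK2 : Module.finrank ℚ K = 2 := hK.1
  haveI : CompactSpace (absoluteGaloisGroup K) := absoluteGaloisGroup_compactSpace K
  haveI : Finite (Literature.NumberTheory.GaloisRepresentations.DiscreteGaloisModule.MuCarrier K (p ^ 1)) :=
    Literature.NumberTheory.EllipticCurves.finite_muCarrier (p ^ 1) K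
  -- separation of the places
  have hsep : ∀ (q' : AdmQ W K p) (v : HeightOneSpectrum (𝓞 K)), q ≠ q' → ((q : ℕ) : 𝓞 K) ∈ v.asIdeal →
      ((q' : ℕ) : 𝓞 K) ∉ v.asIdeal := by
    intro q' v hne hqv hq'v
    have hcop : Nat.Coprime (q : ℕ) (q' : ℕ) := (Nat.coprime_primes q.2.1 q'.2.1).mpr (fun h ↦ hne (Subtype.ext h))
    exact not_mem_asIdeal_of_coprime K hcop v hqv hq'v
  -- the finite sets of places above `N` and above `m`, and `S' = {w} ∪ Nf ∪ Mf`
  have hfinq : ∀ q0 : ℕ, q0 ≠ 0 → {v' : HeightOneSpectrum (𝓞 K) | ((q0 : ℕ) : 𝓞 K) ∈ v'.asIdeal}.Finite := by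
    intro q0 hq0
    have h0 : (Ideal.span {((q0 : ℕ) : 𝓞 K)} : Ideal (𝓞 K)) ≠ 0 := by
      rw [Ne, Ideal.zero_eq_bot, Ideal.span_singleton_eq_bot]; exact_mod_cast hq0
    exact (Ideal.finite_factors h0).subset fun v' hv' ↦ (Ideal.dvd_span_singleton).mpr hv'
  have hNfin : {v' : HeightOneSpectrum (𝓞 K) | ∃ q' ∈ N, ((q' : ℕ) : 𝓞 K) ∈ v'.asIdeal}.Finite := by
    refine ((N : Set (AdmQ W K p)).toFinite.biUnion fun q' _ ↦ hfinq q' q'.2.1.ne_zero).subset ?_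
    intro v' hv'
    obtain ⟨q', hq', hq'v⟩ := hv'
    exact Set.mem_biUnion (Finset.mem_coe.mpr hq') hq'v
  have hMfin : {v' : HeightOneSpectrum (𝓞 K) | ∃ ℓ ∈ m, ((ℓ : ℕ) : 𝓞 K) ∈ v'.asIdeal}.Finite := by
    refine ((m : Set {ℓ // Zhang2014.IsKolyvaginPrime (W.conductorNorm ℤ) W K p ℓ}).toFinite.biUnion
      fun ℓ _ ↦ hfinq (ℓ : ℕ) ℓ.2.1.ne_zero).subset ?_
    intro v' hv'
    obtain ⟨ℓ, hℓ, hℓv⟩ := hv'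
    exact Set.mem_biUnion (Finset.mem_coe.mpr hℓ) hℓv
  set Nf : Finset (Place K) := hNfin.toFinset.image Sum.inr with hNf
  set Mf : Finset (Place K) := hMfin.toFinset.image Sum.inr with hMf
  set S' : Finset (Place K) := insert (Sum.inr w) (Nf ∪ Mf) with hS'
  have hwNM : (Sum.inr w : Place K) ∉ Nf ∪ Mf := by
    intro h
    rcases Finset.mem_union.mp h with h | h
    · rw [hNf, Finset.mem_image] at h
      obtain ⟨v', hv', hvv'⟩ := h
      have hv'w : v' = w := Sum.inr_injective hvv'
      rw [Set.Finite.mem_toFinset] at hv'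
      obtain ⟨q', hq', hq'v'⟩ := hv'
      exact hsep q' w (fun h ↦ hqN (h ▸ hq')) hqw (hv'w ▸ hq'v')
    · rw [hMf, Finset.mem_image] at h
      obtain ⟨v', hv', hvv'⟩ := h
      have hv'w : v' = w := Sum.inr_injective hvv'
      rw [Set.Finite.mem_toFinset] at hv'
      obtain ⟨ℓ, -, hℓv'⟩ := hv'
      exact not_mem_of_kolyvagin_place_P W K p q ℓ.2 w (hv'w ▸ hℓv') hqw
  -- relaxed classes lie in `kummerOutside S'`
  have hout : ∀ z : Vp W K p,
      (∀ u : InfinitePlace K, z ∈ selmerLocalKer (W.baseChange K) u.Completion ((p ^ 1 : ℕ) : ℤ)) →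
      (∀ v : HeightOneSpectrum (𝓞 K), v ≠ w → (∀ ℓ ∈ m, ((ℓ : ℕ) : 𝓞 K) ∉ v.asIdeal) →
        (∀ q' ∈ N, ((q' : ℕ) : 𝓞 K) ∉ v.asIdeal) →
          z ∈ selmerLocalKer (W.baseChange K) (v.adicCompletion K) ((p ^ 1 : ℕ) : ℤ)) →
      z ∈ kummerOutside (W.baseChange K) (p ^ 1) S' := by
    intro z hzinf hzoff
    refine (mem_kummerOutside_iff (W.baseChange K) (p ^ 1) S' z).mpr ?_
    intro pl hpl
    rcases pl with u | v'
    · exact (mem_selmerLocalKer_iff_localization_mem_kummer_inf_P W K p u z).mp (hzinf u)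
    · have hv'w : v' ≠ w := fun h ↦ hpl (by rw [hS', h]; exact Finset.mem_insert_self _ _)
      have hv'N : ∀ q' ∈ N, ((q' : ℕ) : 𝓞 K) ∉ v'.asIdeal := by
        intro q' hq' hq'v'
        apply hpl
        rw [hS']
        exact Finset.mem_insert_of_mem (Finset.mem_union_left _
          (Finset.mem_image_of_mem _ ((Set.Finite.mem_toFinset _).mpr ⟨q', hq', hq'v'⟩)))
      have hv'm : ∀ ℓ ∈ m, ((ℓ : ℕ) : 𝓞 K) ∉ v'.asIdeal := by
        intro ℓ hℓ hℓv'
        apply hpl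
        rw [hS']
        exact Finset.mem_insert_of_mem (Finset.mem_union_right _
          (Finset.mem_image_of_mem _ ((Set.Finite.mem_toFinset _).mpr ⟨ℓ, hℓ, hℓv'⟩)))
      exact (mem_selmerLocalKer_iff_localization_mem_kummer_P W K p v' z).mp (hzoff v' hv'w hv'm hv'N)
  have hrec := KummerPT.sum_invWeilPairing_localization_eq_zero_of_mem_kummerOutside (W.baseChange K) (p ^ 1) e hμ
    hadd₁ hadd₂ hgal halt inv hsum S' (hout x hx.1 hx.2.1) (hout y hy.1 hy.2.1)
  rw [hS', Finset.sum_insert hwNM] at hrec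
  have hzero : ∑ pl ∈ Nf ∪ Mf, invWeilPairing (W.baseChange K) (p ^ 1) e hμ hadd₁ hadd₂ hgal inv pl
      (galoisCohomology.localization ((W.baseChange K).torsionGaloisModule ((p ^ 1 : ℕ) : ℤ)) pl 1 x)
      (galoisCohomology.localization ((W.baseChange K).torsionGaloisModule ((p ^ 1 : ℕ) : ℤ)) pl 1 y) = 0 := by
    refine Finset.sum_eq_zero fun pl hpl ↦ ?_
    rcases Finset.mem_union.mp hpl with hpl | hpl
    · rw [hNf, Finset.mem_image] at hpl
      obtain ⟨v', hv', rfl⟩ := hpl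
      rw [Set.Finite.mem_toFinset] at hv'
      obtain ⟨q', hq', hq'v'⟩ := hv'
      have hxt := (mem_toricLocalKer_iff_res_mem_toricLocalCondition (W.baseChange K) (p ^ 1)
        (v'.adicCompletion K) x).mp (hx.2.2.1 q' hq' v' hq'v')
      have hyt := (mem_toricLocalKer_iff_res_mem_toricLocalCondition (W.baseChange K) (p ^ 1)
        (v'.adicCompletion K) y).mp (hy.2.2.1 q' hq' v' hq'v')
      have h0 := htorIso_toricLocalCondition W K p hK2 q' v' hq'v' e hμ hadd₁ hadd₂ halt hgal _ hxt _ hyt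
      rw [invWeilPairing_apply]
      exact (congrArg (inv (Sum.inr v')) h0).trans (map_zero _)
    · rw [hMf, Finset.mem_image] at hpl
      obtain ⟨v', hv', rfl⟩ := hpl
      rw [Set.Finite.mem_toFinset] at hv'
      obtain ⟨ℓ, hℓ, hℓv'⟩ := hv'
      have h0 := cupProduct_eq_zero_of_mem_transverseLocalKerP W K p hK ι hp2 e hμ hadd₁ hadd₂ hgal ℓ ℓ.2 v' hℓv' x y
        (hx.2.2.2 ℓ hℓ v' hℓv') (hy.2.2.2 ℓ hℓ v' hℓv')
      rw [invWeilPairing_apply]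
      exact (congrArg (inv (Sum.inr v')) h0).trans (map_zero _)
  rw [hzero, add_zero] at hrec
  exact hrec

/-- **The HYPERBOLIC DICHOTOMY for the relaxed structure, from the Poitou–Tate fact alone**: `K` imaginary quadratic,
`p` odd, the named PT fact; a class of the level structure `(N, m)` relaxed at the place `w ∋ q` of an admissible `q ∉ N`
(Kummer at `∞` and off `w ∪ N ∪ m`, toric above `N`, transverse above `m`) satisfies E's Kummer condition at `w` OR the
toric condition at `w`. Proof: `(REC)` with `x = y = z` makes `loc_w z` isotropic for the local Tate pairing through a Weil
pairing (`exists_weilPairing_holds`, the PT family of `hPT`), and an isotropic class of the hyperbolic plane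
`H¹(K_w, E[p]) = F ⊕ O` lies on one of the two lines (`mem_selmerLocalKer_or_mem_toricLocalKer_of_isotropic_free`).
[cite: BertoliniDarmon2005, Lemma 2.6] [cite: WZhang2014, Lemma 5.1, Lemma 5.3] [cite: MilneADT2006, Ch. I, Thm. 4.10] -/
theorem mem_selmerLocalKer_or_mem_toricLocalKer_of_relaxedTransverse (hK : IsImaginaryQuadratic K) (hp2 : p ≠ 2)
    (hPT : poitouTate_selmerStructure_duality K)
    (N : Finset (AdmQ W K p)) (m : Finset {ℓ // Zhang2014.IsKolyvaginPrime (W.conductorNorm ℤ) W K p ℓ})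
    (q : AdmQ W K p) (w : HeightOneSpectrum (𝓞 K)) (hqN : q ∉ N) (hqw : ((q : ℕ) : 𝓞 K) ∈ w.asIdeal) (z : Vp W K p)
    (hz : (∀ u : InfinitePlace K, z ∈ selmerLocalKer (W.baseChange K) u.Completion ((p ^ 1 : ℕ) : ℤ)) ∧
      (∀ v : HeightOneSpectrum (𝓞 K), v ≠ w → (∀ ℓ ∈ m, ((ℓ : ℕ) : 𝓞 K) ∉ v.asIdeal) →
        (∀ q' ∈ N, ((q' : ℕ) : 𝓞 K) ∉ v.asIdeal) →
          z ∈ selmerLocalKer (W.baseChange K) (v.adicCompletion K) ((p ^ 1 : ℕ) : ℤ)) ∧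
      (∀ q' ∈ N, ∀ v : HeightOneSpectrum (𝓞 K), ((q' : ℕ) : 𝓞 K) ∈ v.asIdeal →
          z ∈ toricLocalKer (W.baseChange K) (v.adicCompletion K) ((p ^ 1 : ℕ) : ℤ)) ∧
      (∀ ℓ ∈ m, ∀ v : HeightOneSpectrum (𝓞 K), ((ℓ : ℕ) : 𝓞 K) ∈ v.asIdeal → z ∈ transverseLocalKerP W K p ι ℓ v)) :
    z ∈ selmerLocalKer (W.baseChange K) (w.adicCompletion K) ((p ^ 1 : ℕ) : ℤ) ∨
      z ∈ toricLocalKer (W.baseChange K) (w.adicCompletion K) ((p ^ 1 : ℕ) : ℤ) := by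
  have hp : p.Prime := Fact.out
  haveI : NeZero (p ^ 1 : ℕ) := ⟨pow_ne_zero 1 hp.ne_zero⟩
  haveI : Finite (geomTorsion (W.baseChange K) ((p ^ 1 : ℕ) : ℤ)) :=
    finite_geomTorsion_of_neZero (W.baseChange K) (p ^ 1)
  have h2p : 2 ≤ p ^ 1 := by rw [pow_one]; exact hp.two_le
  obtain ⟨e, hμ, hadd₁, hadd₂, halt, hnondeg, hgal⟩ :=
    exists_weilPairing_holds (W.baseChange K) (p ^ 1) h2p (by exact_mod_cast pow_ne_zero 1 hp.ne_zero)
  obtain ⟨inv, hperf, hsum, -, -⟩ := hPT (p ^ 1)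
  exact mem_selmerLocalKer_or_mem_toricLocalKer_of_isotropic_free W K p hK hp2 q w hqw e hμ hadd₁ hadd₂ halt hnondeg hgal
    inv hperf (invWeilPairing_localization_eq_zero_of_relaxedTransverse W K p ι hK hp2 e hμ hadd₁ hadd₂ halt hgal inv hsum
      N m q w hqN hqw z z hz hz)

end Summit.BirchSwinnertonDyer.BirchSwinnertonDyer.Theorems.AdditiveKoly

end
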